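import Literature.MathematicalPhysics.QuantumManyBody.PeriodicBoseGasFracEnergy
import Literature.MathematicalPhysics.QuantumManyBody.PeriodicCondensateCoherence
import Literature.Analysis.FunctionSpaces.TorusHeatKernel
import Mathlib.Analysis.Normed.Group.FunctionSeries
import HarnessLib

/-!
# Route `BECDipoleTransport`, support `TransportToWindow` (stmt-AtomisticToContinuum-14624) —
# measurability of the dipole transport term and the three-slot splitting

Helper file (`--supports` stmt-AtomisticToContinuum-14624) for the proof of
`Summit.AtomisticToContinuum.BoseEinsteinCondensation.Theses.BECDipoleTransport.TransportToWindow`.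
The glue `Leg 1 ∧ Leg 2 ⇒ Gaussian window` bounds `∭|Ψ̄_R(x′) − Ψ̄_R(x)|²` by
`2∭|Ψ̄_R(x′) − Ψ̄_R(x) + GΨ̄_R(x)|² + 2∭|GΨ̄_R(x)|²`; since `∫⁻` is a *lower* integral, splitting the
sum of the two integrands needs MEASURABILITY of the transport term `G…` jointly in `(x, x′, Y)`.
This file proves it for the explicit Gaussian-damped dipole field of the route:

* `continuous_dipoleSum`, `continuous_dipoleDivSum` — the lattice sums
  `Σ_κ e^{-R²c²|κ|²/4}(κᵢ/(c|κ|²))(sin(cκ·(y−x′)) − sin(cκ·(y−x)))` and the `cos` analogue converge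
  uniformly (`|κᵢ| ≤ |κ|²` on `ℤ³`, summable Gaussian weights `summable_gaussWeight` from the torus
  heat coefficients) and are jointly continuous in `(x, x′, y)` (`continuous_tsum`);
* `continuous_transportIntegrand`, `measurable_transportTerm`, `measurable_dipoleTransportTerm` —
  the integrand `η_R(x−z) Σ_j[∇_{j+1}Ψ(z,Y)·φ(y_j) + ½(div φ)(y_j)Ψ(z,Y)]` is jointly continuous,
  so the `z`-integral is jointly measurable (`StronglyMeasurable.integral_prod_right'`);
* `lintegral_cell3_add`, `lintegral_cell3_sq_le_of_add` — additivity of the iterated integral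
  `∫_x∫_x′∫_Y` for a measurable summand, and the splitting
  `∭|u|² ≤ 2a + 2b` from `∭|u + G|² ≤ a`, `∭|G|² ≤ b` for measurable `u`, `G`.

No new definitions. References: Mathlib `Analysis.Normed.Group.FunctionSeries`
(`continuous_tsum`), `MeasureTheory.Measure.Prod`.
-/

noncomputable section

namespace Summit.AtomisticToContinuum.BoseEinsteinCondensation.Theorems.BECDipoleTransport

open MeasureTheory
open scoped ENNReal ComplexConjugate
open Literature.MathematicalPhysics.QuantumManyBody.BoseGas

variable {L : ℝ} {n : ℕ}


/-! ### The Gaussian-damped dipole lattice sums are continuous -/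

/-- The Gaussian weights `e^{-R²c²|κ|²/4}` are summable over `ℤ³` (`R, c ≠ 0`). [folklore] -/
theorem summable_gaussWeight {R c : ℝ} (hR : R ≠ 0) (hc : c ≠ 0) :
    Summable fun κ : Fin 3 → ℤ => Real.exp (-(R ^ 2 * c ^ 2 * (∑ l, (κ l : ℝ) ^ 2) / 4)) := by
  have ht : 0 < R ^ 2 * c ^ 2 / (16 * Real.pi ^ 2) := by positivity
  refine (Literature.Analysis.FunctionSpaces.Torus.summable_heatCoeff (d := Fin 3) ht).congr
    fun κ => ?_
  rw [Literature.Analysis.FunctionSpaces.Torus.heatCoeff_apply,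
    Literature.Analysis.FunctionSpaces.Torus.freqNormSq]
  congr 1
  field_simp
  ring

/-- `|κᵢ| ≤ |κ|²` for an integer vector. [folklore] -/
theorem abs_intCast_le_sum_sq (κ : Fin 3 → ℤ) (i : Fin 3) :
    |(κ i : ℝ)| ≤ ∑ l, (κ l : ℝ) ^ 2 := by
  have h1 : |(κ i : ℝ)| ≤ (κ i : ℝ) ^ 2 := by
    rcases eq_or_ne (κ i) 0 with h | h
    · simp [h]
    · have : (1 : ℝ) ≤ |(κ i : ℝ)| := by
        rw [← Int.cast_abs]; exact_mod_cast Int.one_le_abs h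
      calc |(κ i : ℝ)| = |(κ i : ℝ)| * 1 := (mul_one _).symm
        _ ≤ |(κ i : ℝ)| * |(κ i : ℝ)| := mul_le_mul_of_nonneg_left this (abs_nonneg _)
        _ = (κ i : ℝ) ^ 2 := by rw [← sq, sq_abs]
  exact h1.trans (Finset.single_le_sum (f := fun l => (κ l : ℝ) ^ 2) (fun l _ => sq_nonneg _)
    (Finset.mem_univ i))

/-- The dipole amplitude `κᵢ/(c|κ|²)` is bounded by `|c|⁻¹` (value `0` at `κ = 0`). [folklore] -/
theorem abs_dipoleAmp_le (c : ℝ) (κ : Fin 3 → ℤ) (i : Fin 3) :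
    |(κ i : ℝ) / (c * ∑ l, (κ l : ℝ) ^ 2)| ≤ |c|⁻¹ := by
  rcases eq_or_ne c 0 with hc | hc
  · simp [hc]
  set S : ℝ := ∑ l, (κ l : ℝ) ^ 2 with hS
  have hS0 : 0 ≤ S := Finset.sum_nonneg fun l _ => sq_nonneg _
  rcases hS0.eq_or_lt with h0 | hpos
  · rw [← h0, mul_zero, div_zero, abs_zero]; positivity
  · rw [abs_div, abs_mul, abs_of_pos hpos, div_le_iff₀ (by positivity)]
    calc |(κ i : ℝ)| ≤ S := abs_intCast_le_sum_sq κ i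
      _ = |c|⁻¹ * (|c| * S) := by field_simp

/-- **Continuity of the dipole field components.** The Gaussian-damped lattice sum
`(x, x′, y) ↦ Σ_κ e^{-R²c²|κ|²/4} (κᵢ/(c|κ|²)) (sin(cκ·(y−x′)) − sin(cκ·(y−x)))` converges uniformly
and is jointly continuous (`R, c ≠ 0`). [folklore] -/
theorem continuous_dipoleSum {R c : ℝ} (hR : R ≠ 0) (hc : c ≠ 0) (i : Fin 3) :
    Continuous fun q : Space × Space × Space => ∑' κ : Fin 3 → ℤ,
      Real.exp (-(R ^ 2 * c ^ 2 * (∑ l, (κ l : ℝ) ^ 2) / 4)) *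
        ((κ i : ℝ) / (c * ∑ l, (κ l : ℝ) ^ 2)) *
        (Real.sin (c * ∑ l, (κ l : ℝ) * (q.2.2 l - q.2.1 l)) -
          Real.sin (c * ∑ l, (κ l : ℝ) * (q.2.2 l - q.1 l))) := by
  refine continuous_tsum (u := fun κ : Fin 3 → ℤ =>
    Real.exp (-(R ^ 2 * c ^ 2 * (∑ l, (κ l : ℝ) ^ 2) / 4)) * |c|⁻¹ * 2) (fun κ => ?_)
    (((summable_gaussWeight hR hc).mul_right _).mul_right _) fun κ q => ?_
  · fun_prop
  · rw [Real.norm_eq_abs, abs_mul, abs_mul, abs_of_pos (Real.exp_pos _)]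
    gcongr
    · exact abs_dipoleAmp_le c κ i
    · exact (abs_sub _ _).trans (by
        have := Real.abs_sin_le_one (c * ∑ l, (κ l : ℝ) * (q.2.2 l - q.2.1 l))
        have := Real.abs_sin_le_one (c * ∑ l, (κ l : ℝ) * (q.2.2 l - q.1 l))
        linarith)

/-- **Continuity of the dipole divergence.** The Gaussian-damped lattice sum
`(x, x′, y) ↦ Σ_κ e^{-R²c²|κ|²/4} (cos(cκ·(y−x′)) − cos(cκ·(y−x)))` is jointly continuous
(`R, c ≠ 0`). [folklore] -/
theorem continuous_dipoleDivSum {R c : ℝ} (hR : R ≠ 0) (hc : c ≠ 0) :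
    Continuous fun q : Space × Space × Space => ∑' κ : Fin 3 → ℤ,
      Real.exp (-(R ^ 2 * c ^ 2 * (∑ l, (κ l : ℝ) ^ 2) / 4)) *
        (Real.cos (c * ∑ l, (κ l : ℝ) * (q.2.2 l - q.2.1 l)) -
          Real.cos (c * ∑ l, (κ l : ℝ) * (q.2.2 l - q.1 l))) := by
  refine continuous_tsum (u := fun κ : Fin 3 → ℤ =>
    Real.exp (-(R ^ 2 * c ^ 2 * (∑ l, (κ l : ℝ) ^ 2) / 4)) * 2) (fun κ => ?_)
    ((summable_gaussWeight hR hc).mul_right _) fun κ q => ?_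
  · fun_prop
  · rw [Real.norm_eq_abs, abs_mul, abs_of_pos (Real.exp_pos _)]
    gcongr
    exact (abs_sub _ _).trans (by
      have := Real.abs_cos_le_one (c * ∑ l, (κ l : ℝ) * (q.2.2 l - q.2.1 l))
      have := Real.abs_cos_le_one (c * ∑ l, (κ l : ℝ) * (q.2.2 l - q.1 l))
      linarith)


/-! ### Measurability of the transport term -/

/-- `v ↦ e_i ⊗ v` (`Pi.single`) is continuous. [folklore] -/
theorem continuous_piSingle (i : Fin (n + 1)) :
    Continuous fun v : Space => (Pi.single i v : Config (n + 1)) :=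
  continuous_const.update i continuous_id

/-- **Continuity of the transport integrand.** For `Ψ ∈ C¹((ℝ³)^{n+1})`, a continuous displacement
field `Φ(x,x′,y) ∈ ℝ³` and a continuous divergence `D(x,x′,y)`, the integrand of the first-order
transport term, `((x,x′,Y), z) ↦ η_R(x−z) Σ_j [∇_{j+1}Ψ(z,Y)·Φ(x,x′,y_j) + ½D(x,x′,y_j)Ψ(z,Y)]`,
is jointly continuous. [folklore] -/
theorem continuous_transportIntegrand {Ψ : Config (n + 1) → ℂ} (hΨ : ContDiff ℝ 1 Ψ)
    {Φ : Space → Space → Space → Space}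
    (hΦ : Continuous fun r : Space × Space × Space => Φ r.1 r.2.1 r.2.2)
    {D : Space → Space → Space → ℝ} (hD : Continuous fun r : Space × Space × Space => D r.1 r.2.1 r.2.2)
    (A R : ℝ) :
    Continuous fun q : (Space × Space × Config n) × Space =>
      ((A * Real.exp (-(‖q.1.1 - q.2‖ ^ 2 / R ^ 2)) : ℝ) : ℂ) * ∑ j : Fin n,
        (fderiv ℝ Ψ (Matrix.vecCons q.2 q.1.2.2) (Pi.single (Fin.succ j) (Φ q.1.1 q.1.2.1 (q.1.2.2 j))) +
          ((D q.1.1 q.1.2.1 (q.1.2.2 j) / 2 : ℝ) : ℂ) * Ψ (Matrix.vecCons q.2 q.1.2.2)) := by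
  have hd : Continuous (fderiv ℝ Ψ) := hΨ.continuous_fderiv one_ne_zero
  have hvec : Continuous fun q : (Space × Space × Config n) × Space =>
      (Matrix.vecCons q.2 q.1.2.2 : Config (n + 1)) :=
    continuous_snd.matrixVecCons (continuous_snd.comp (continuous_snd.comp continuous_fst))
  refine (Complex.continuous_ofReal.comp (by fun_prop)).mul
    (continuous_finsetSum _ fun j _ => ?_)
  have hr : Continuous fun q : (Space × Space × Config n) × Space =>
      ((q.1.1, q.1.2.1, q.1.2.2 j) : Space × Space × Space) := by fun_prop
  refine ((hd.comp hvec).clm_apply ((continuous_piSingle (Fin.succ j)).comp (hΦ.comp hr))).add ?_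
  exact (Complex.continuous_ofReal.comp ((hD.comp hr).div_const 2)).mul (hΨ.continuous.comp hvec)

/-- **Measurability of the transport term.** With `Φ`, `D` as above, the first-order transport
term `(x,x′,Y) ↦ ∫ η_R(x−z) Σ_j [∇_{j+1}Ψ(z,Y)·Φ(x,x′,y_j) + ½D(x,x′,y_j)Ψ(z,Y)] dz` is jointly
measurable (a parametric Bochner integral of a jointly continuous integrand,
`StronglyMeasurable.integral_prod_right'`). [folklore] -/
theorem measurable_transportTerm {Ψ : Config (n + 1) → ℂ} (hΨ : ContDiff ℝ 1 Ψ)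
    {Φ : Space → Space → Space → Space}
    (hΦ : Continuous fun r : Space × Space × Space => Φ r.1 r.2.1 r.2.2)
    {D : Space → Space → Space → ℝ} (hD : Continuous fun r : Space × Space × Space => D r.1 r.2.1 r.2.2)
    (A R : ℝ) :
    Measurable fun p : Space × Space × Config n =>
      ∫ z : Space, ((A * Real.exp (-(‖p.1 - z‖ ^ 2 / R ^ 2)) : ℝ) : ℂ) * ∑ j : Fin n,
        (fderiv ℝ Ψ (Matrix.vecCons z p.2.2) (Pi.single (Fin.succ j) (Φ p.1 p.2.1 (p.2.2 j))) +
          ((D p.1 p.2.1 (p.2.2 j) / 2 : ℝ) : ℂ) * Ψ (Matrix.vecCons z p.2.2)) :=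
  ((continuous_transportIntegrand hΨ hΦ hD A R).stronglyMeasurable.integral_prod_right'
    (ν := (volume : Measure Space))).measurable

/-- **Continuity of the dipole field** `(x, x′, y) ↦ φ_{x,x′}(y) ∈ ℝ³` (all three components are
the uniformly convergent lattice sums of `continuous_dipoleSum`, scaled by `a`). [folklore] -/
theorem continuous_dipoleField {R c : ℝ} (hR : R ≠ 0) (hc : c ≠ 0) (a : ℝ) :
    Continuous fun r : Space × Space × Space => (WithLp.toLp 2 fun i : Fin 3 => a * ∑' κ : Fin 3 → ℤ,
      Real.exp (-(R ^ 2 * c ^ 2 * (∑ l, (κ l : ℝ) ^ 2) / 4)) *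
        ((κ i : ℝ) / (c * ∑ l, (κ l : ℝ) ^ 2)) *
        (Real.sin (c * ∑ l, (κ l : ℝ) * (r.2.2 l - r.2.1 l)) -
          Real.sin (c * ∑ l, (κ l : ℝ) * (r.2.2 l - r.1 l))) : Space) :=
  (PiLp.continuous_toLp 2 _).comp (continuous_pi fun i =>
    continuous_const.mul (continuous_dipoleSum hR hc i))

/-- **Continuity of the scaled dipole divergence** `(x, x′, y) ↦ a Σ_κ g(κ)(cos − cos)`. [folklore] -/
theorem continuous_dipoleDiv {R c : ℝ} (hR : R ≠ 0) (hc : c ≠ 0) (a : ℝ) :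
    Continuous fun r : Space × Space × Space => a * ∑' κ : Fin 3 → ℤ,
      Real.exp (-(R ^ 2 * c ^ 2 * (∑ l, (κ l : ℝ) ^ 2) / 4)) *
        (Real.cos (c * ∑ l, (κ l : ℝ) * (r.2.2 l - r.2.1 l)) -
          Real.cos (c * ∑ l, (κ l : ℝ) * (r.2.2 l - r.1 l))) :=
  continuous_const.mul (continuous_dipoleDivSum hR hc)

/-- **Measurability of the dipole transport term of route `BECDipoleTransport`** (the generator
`G` of `HoleLinearResponse` / `DipoleTransportCost` applied to the smeared slice), jointly in
`(x, x′, Y)`: the instance of `measurable_transportTerm` with the explicit Gaussian-damped dipole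
field and divergence. [folklore] -/
theorem measurable_dipoleTransportTerm {Ψ : Config (n + 1) → ℂ} (hΨ : ContDiff ℝ 1 Ψ)
    (A a R c : ℝ) (hR : R ≠ 0) (hc : c ≠ 0) :
    Measurable fun p : Space × Space × Config n =>
      ∫ z : Space, ((A * Real.exp (-(‖p.1 - z‖ ^ 2 / R ^ 2)) : ℝ) : ℂ) * ∑ j : Fin n,
        (fderiv ℝ Ψ (Matrix.vecCons z p.2.2) (Pi.single (Fin.succ j)
          (WithLp.toLp 2 fun i : Fin 3 => a * ∑' κ : Fin 3 → ℤ,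
            Real.exp (-(R ^ 2 * c ^ 2 * (∑ l, (κ l : ℝ) ^ 2) / 4)) *
              ((κ i : ℝ) / (c * ∑ l, (κ l : ℝ) ^ 2)) *
              (Real.sin (c * ∑ l, (κ l : ℝ) * (p.2.2 j l - p.2.1 l)) -
                Real.sin (c * ∑ l, (κ l : ℝ) * (p.2.2 j l - p.1 l))))) +
          (((a * ∑' κ : Fin 3 → ℤ, Real.exp (-(R ^ 2 * c ^ 2 * (∑ l, (κ l : ℝ) ^ 2) / 4)) *
              (Real.cos (c * ∑ l, (κ l : ℝ) * (p.2.2 j l - p.2.1 l)) -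
                Real.cos (c * ∑ l, (κ l : ℝ) * (p.2.2 j l - p.1 l)))) / 2 : ℝ) : ℂ) *
            Ψ (Matrix.vecCons z p.2.2)) :=
  measurable_transportTerm
    (Φ := fun x x' y => (WithLp.toLp 2 fun i : Fin 3 => a * ∑' κ : Fin 3 → ℤ,
      Real.exp (-(R ^ 2 * c ^ 2 * (∑ l, (κ l : ℝ) ^ 2) / 4)) *
        ((κ i : ℝ) / (c * ∑ l, (κ l : ℝ) ^ 2)) *
        (Real.sin (c * ∑ l, (κ l : ℝ) * (y l - x' l)) -
          Real.sin (c * ∑ l, (κ l : ℝ) * (y l - x l))) : Space))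
    (D := fun x x' y => a * ∑' κ : Fin 3 → ℤ,
      Real.exp (-(R ^ 2 * c ^ 2 * (∑ l, (κ l : ℝ) ^ 2) / 4)) *
        (Real.cos (c * ∑ l, (κ l : ℝ) * (y l - x' l)) -
          Real.cos (c * ∑ l, (κ l : ℝ) * (y l - x l))))
    hΨ (continuous_dipoleField hR hc a) (continuous_dipoleDiv hR hc a) A R


/-! ### Splitting the three-slot lower integral -/

/-- `|u|² ≤ 2|u + g|² + 2|g|²` in `ℝ≥0∞`. [folklore] -/
theorem nnnorm_sq_le_two_mul_add (u g : ℂ) :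
    ((‖u‖₊ : ℝ≥0∞) ^ 2) ≤ 2 * (‖u + g‖₊ : ℝ≥0∞) ^ 2 + 2 * (‖g‖₊ : ℝ≥0∞) ^ 2 := by
  have key : ‖u‖ ^ 2 ≤ 2 * ‖u + g‖ ^ 2 + 2 * ‖g‖ ^ 2 := by
    have h := norm_sub_le (u + g) g
    rw [add_sub_cancel_right] at h
    nlinarith [sq_nonneg (‖u + g‖ - ‖g‖), norm_nonneg (u + g), norm_nonneg g, norm_nonneg u]
  rw [coe_nnnorm_sq_eq_ofReal, coe_nnnorm_sq_eq_ofReal, coe_nnnorm_sq_eq_ofReal,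
    ← ENNReal.ofReal_ofNat 2, ← ENNReal.ofReal_mul zero_le_two, ← ENNReal.ofReal_mul zero_le_two,
    ← ENNReal.ofReal_add (by positivity) (by positivity)]
  exact ENNReal.ofReal_le_ofReal key

/-- **Additivity of the iterated cell integral** `∫_x∫_x′∫_Y (P + Q) = ∭P + ∭Q` when `P` is jointly
measurable (`Q` arbitrary: `lintegral_add_left` at each level, with the measurability of the
partial integrals of `P` from Tonelli). [folklore] -/
theorem lintegral_cell3_add {P Q : Space → Space → Config n → ℝ≥0∞}
    (hP : Measurable fun p : Space × Space × Config n => P p.1 p.2.1 p.2.2) :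
    ∫⁻ x in cell L, ∫⁻ x' in cell L, ∫⁻ Y in cellN n L, (P x x' Y + Q x x' Y) =
      (∫⁻ x in cell L, ∫⁻ x' in cell L, ∫⁻ Y in cellN n L, P x x' Y) +
        ∫⁻ x in cell L, ∫⁻ x' in cell L, ∫⁻ Y in cellN n L, Q x x' Y := by
  have hY : ∀ x x' : Space, Measurable fun Y : Config n => P x x' Y := fun x x' =>
    hP.comp (measurable_const.prodMk (measurable_const.prodMk measurable_id))
  have hq : ∀ x : Space, Measurable fun q : Space × Config n => P x q.1 q.2 := fun x =>
    hP.comp (measurable_const.prodMk measurable_id)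
  have h_in : ∀ x x' : Space, ∫⁻ Y in cellN n L, (P x x' Y + Q x x' Y) =
      (∫⁻ Y in cellN n L, P x x' Y) + ∫⁻ Y in cellN n L, Q x x' Y := fun x x' =>
    lintegral_add_left (hY x x') _
  simp_rw [h_in]
  have hI1 : ∀ x : Space, Measurable fun x' : Space => ∫⁻ Y in cellN n L, P x x' Y := fun x =>
    (hq x).lintegral_prod_right
  have h_mid : ∀ x : Space, ∫⁻ x' in cell L, ((∫⁻ Y in cellN n L, P x x' Y) +
      ∫⁻ Y in cellN n L, Q x x' Y) = (∫⁻ x' in cell L, ∫⁻ Y in cellN n L, P x x' Y) +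
        ∫⁻ x' in cell L, ∫⁻ Y in cellN n L, Q x x' Y := fun x => lintegral_add_left (hI1 x) _
  simp_rw [h_mid]
  have hr : Measurable fun r : (Space × Space) × Config n =>
      ((r.1.1, r.1.2, r.2) : Space × Space × Config n) := by fun_prop
  have hI2 : Measurable fun x : Space => ∫⁻ x' in cell L, ∫⁻ Y in cellN n L, P x x' Y := by
    refine Measurable.lintegral_prod_right (f := fun x x' => ∫⁻ Y in cellN n L, P x x' Y) ?_
    exact Measurable.lintegral_prod_right (f := fun (q : Space × Space) (Y : Config n) => P q.1 q.2 Y)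
      (hP.comp hr)
  exact lintegral_add_left hI2 _

/-- `∭ (c · P) = c ∭ P` for a finite constant (no measurability needed). [folklore] -/
theorem lintegral_cell3_const_mul {c : ℝ≥0∞} (hc : c ≠ ⊤) (P : Space → Space → Config n → ℝ≥0∞) :
    ∫⁻ x in cell L, ∫⁻ x' in cell L, ∫⁻ Y in cellN n L, c * P x x' Y =
      c * ∫⁻ x in cell L, ∫⁻ x' in cell L, ∫⁻ Y in cellN n L, P x x' Y := by
  simp_rw [lintegral_const_mul' _ _ hc]

/-- **Three-slot splitting.** For jointly measurable `u`, `G` on `cell × cell × cell^n`: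
`∭|G|² ≤ b` and `∭|u + G|² ≤ a` give `∭|u|² ≤ 2a + 2b` (pointwise `|u|² ≤ 2|u+G|² + 2|G|²`;
the measurability of `2|u+G|²` makes the lower integral additive). [folklore] -/
theorem lintegral_cell3_sq_le_of_add {u G : Space → Space → Config n → ℂ}
    (hu : Measurable fun p : Space × Space × Config n => u p.1 p.2.1 p.2.2)
    (hG : Measurable fun p : Space × Space × Config n => G p.1 p.2.1 p.2.2) {a b : ℝ≥0∞}
    (h1 : ∫⁻ x in cell L, ∫⁻ x' in cell L, ∫⁻ Y in cellN n L,
      (‖G x x' Y‖₊ : ℝ≥0∞) ^ 2 ≤ b)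
    (h2 : ∫⁻ x in cell L, ∫⁻ x' in cell L, ∫⁻ Y in cellN n L,
      (‖u x x' Y + G x x' Y‖₊ : ℝ≥0∞) ^ 2 ≤ a) :
    ∫⁻ x in cell L, ∫⁻ x' in cell L, ∫⁻ Y in cellN n L, (‖u x x' Y‖₊ : ℝ≥0∞) ^ 2 ≤
      2 * a + 2 * b := by
  have hPm : Measurable fun p : Space × Space × Config n =>
      2 * (‖u p.1 p.2.1 p.2.2 + G p.1 p.2.1 p.2.2‖₊ : ℝ≥0∞) ^ 2 :=
    ((hu.add hG).nnnorm.coe_nnreal_ennreal.pow_const 2).const_mul 2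
  calc ∫⁻ x in cell L, ∫⁻ x' in cell L, ∫⁻ Y in cellN n L, (‖u x x' Y‖₊ : ℝ≥0∞) ^ 2
      ≤ ∫⁻ x in cell L, ∫⁻ x' in cell L, ∫⁻ Y in cellN n L,
          (2 * (‖u x x' Y + G x x' Y‖₊ : ℝ≥0∞) ^ 2 + 2 * (‖G x x' Y‖₊ : ℝ≥0∞) ^ 2) :=
        lintegral_mono fun x => lintegral_mono fun x' => lintegral_mono fun Y =>
          nnnorm_sq_le_two_mul_add _ _
    _ = 2 * (∫⁻ x in cell L, ∫⁻ x' in cell L, ∫⁻ Y in cellN n L,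
          (‖u x x' Y + G x x' Y‖₊ : ℝ≥0∞) ^ 2) +
        2 * ∫⁻ x in cell L, ∫⁻ x' in cell L, ∫⁻ Y in cellN n L, (‖G x x' Y‖₊ : ℝ≥0∞) ^ 2 := by
        rw [lintegral_cell3_add (P := fun x x' Y => 2 * (‖u x x' Y + G x x' Y‖₊ : ℝ≥0∞) ^ 2) hPm,
          lintegral_cell3_const_mul ENNReal.ofNat_ne_top, lintegral_cell3_const_mul ENNReal.ofNat_ne_top]
    _ ≤ 2 * a + 2 * b := add_le_add (mul_le_mul' le_rfl h2) (mul_le_mul' le_rfl h1)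

end Summit.AtomisticToContinuum.BoseEinsteinCondensation.Theorems.BECDipoleTransport

end
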